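import Summits.BirchSwinnertonDyer.BirchSwinnertonDyer.Theorems.GenusKolyvaginAtTwoGenusPrimitiveSupplyAtTwoArchimedeanKummerCount
import Summits.BirchSwinnertonDyer.BirchSwinnertonDyer.Theorems.GenusKolyvaginAtTwoGenusPrimitiveSupplyAtTwoSelmerTransferDown
import HarnessLib

/-!
# Route `GenusKolyvaginAtTwo`, crux U₂ `MinimalTwinBSDTwo` (stmt-BirchSwinnertonDyer-22985), LINE 23 «twin_swap»: THE IDENTITY-PRIME DOOR, part 1 —
# the mixed two-place Kummer count `[H¹_{𝓚^{w,v₀}} : H¹_{𝓚_{w,v₀}}] = #𝓛_w · t_{v₀}` (one INFINITE and one FINITE place) and the abstract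
# «relaxed-at-∞ injectivity» transfer law `#Sel^{(p)}(Y) · #H¹_{𝓚_{w}}(E) ∣ t_{v₀}(E, p)` for a congruent pair `Y[p] ≅ E[p]`

Seat `bsd-line-gk2-p2` g26 (PROVER seat 2/3, cell `bsd-f1-sign2`, LINE 23 holder), `--supports stmt-BirchSwinnertonDyer-22985` (helper; closes nothing).
THEOREMS ONLY (no definition, no named fact, no `sorry`); standard axioms.  **BSD is NOT proved by this file; U₂ is NOT proved; nothing is closed.**

WHY.  LINE 23's only remaining declared residual (v1.8/v1.9, OFF″) is the `Δ > 0` IDENTITY LOCUS of U₂: rank-one `W` with `#Sel₂(W) = 2` whose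
generator lies on the identity real component (`¬ MeetsEgg W`), i.e. `Sel₂(W)` is STRICT at `∞`.  There no SILENT reversed twin is `2`-Selmer-trivial
(`Egg.natCard_selmerGroup_twin_of_silent`: `#Sel₂ = 4`) and the two-transposition count only reaches `{1, 4}` (`GenusKolyTransp.twoTranspositionTwistLaw_card`).
This file and its sequel prove that an IDENTITY prime `ℓ` (`W[2] ⊂ W(ℚ_ℓ)`, `t_ℓ = 4`) whose localisation is INJECTIVE on the ∞-relaxed Selmer group
`Sel₂^{rel ∞}(W)` (order `4` on the identity locus) DOES give `#Sel₂(W^{(−ℓ)}) = 1` — Mazur–Rubin's method at `T = {∞, ℓ}`, the real place being the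
cell's own case (MR 2010 Prop. 3.3 as printed lets the real places split).

WHAT (this part, every number field `K`, every prime `p` / prime power `n`).
* §1 `relIndex_kummer_update₂_inl_inr_eq` / **`relIndex_kummerStrict_kummerRelaxed_inl_inr_eq_of_facts`** — the MIXED two-place Kummer count:
  for a real place `w` and a finite place `v₀`, `[H¹_{𝓚^{w,v₀}} : H¹_{𝓚_{w,v₀}}] = #𝓛_w · (#E(K_{v₀})[p] · #(𝓞_{v₀}/p))` (Mazur–Rubin Lemma 3.2 with
  `T = {w, v₀}`): the chain `𝓚_{w,v₀} ≤ 𝓚_{v₀} ≤ 𝓚^{v₀} ≤ 𝓚^{w,v₀}`, X5's finite one-place count in the middle, and Howard's count at the REAL place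
  `w` (gk2-p5 §41–§43, `relIndex_selmerGroup_mul_relIndex_dual_eq_of_bijective`) for the pair `𝓚^{v₀} ≤ 𝓚^{w,v₀}` whose transported duals are
  `𝓚_{v₀}`, `𝓚_{w,v₀}` — so the two outer indices multiply to `#𝓛_w`.
* §2 **`natCard_selmerGroup_mul_natCard_dvd_of_transverse_of_injective_relaxed`** — THE ABSTRACT IDENTITY-DOOR LAW: for a congruent pair
  `φ : Y[p] ⥲ E[p]` with transported structure `𝓐 = φ_* 𝓚_Y` agreeing with `𝓚_E` off `{w, v₀}`, TRANSVERSE to it at `v₀` (`𝓐_{v₀} ⊓ 𝓚_{v₀} = ⊥`,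
  Lemma 2.11), and `loc_{v₀}` INJECTIVE on `H¹_{𝓚^{w}}(E)` (the ∞-relaxed Selmer group): **`#Sel^{(p)}(Y) · #H¹_{𝓚_{w}}(E) ∣ t_{v₀}(E, p)`**.
  Proof: `H¹_{𝓚_{w,v₀}} = 0` (injectivity), so `#H¹_{𝓚^{w,v₀}} = #𝓛_w · t_{v₀}` (§1) and `#H¹_{𝓚^{w}} = #𝓛_w · #H¹_{𝓚_{w}}` (gk2-p5's archimedean count);
  `H¹_𝓐 ≤ H¹_{𝓚^{w,v₀}}` (agreement) meets `H¹_{𝓚^{w}}` trivially (transversality + injectivity), so `#H¹_𝓐 · #H¹_{𝓚^w} ∣ #H¹_{𝓚^{w,v₀}}`; transport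
  `#H¹_𝓐 = #Sel(Y)`.  NO condition at `w` on `𝓐` is needed — the real place is absorbed by the relaxation.
All modulo the two standard print facts `poitouTate_selmerStructure_duality_real K` / `localEulerPoincareCharacteristic` as HYPOTHESES (X11b style;
both are tree theorems over every number field, discharged in part 2).

References: [MazurRubin2010] Def. 3.1, Lemma 3.2, Prop. 3.3, Lemmas 2.9–2.11; [Howard2004HeegnerKolyvagin] Thm. 2.1.11; [MilneADT2006] I Thm. 2.8, 2.13,
4.10, Lemma 6.15; [Kramer1981] Prop. 6, Thm. 1; [Sakamoto2024] §3.1.2.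
-/

set_option linter.dupNamespace false -- tree convention: `Summit.BirchSwinnertonDyer.BirchSwinnertonDyer.Theorems` (summit = sub-problem)
set_option autoImplicit false

noncomputable section

open scoped Classical ContRepresentation

open CategoryTheory Field Function NumberField IsDedekindDomain WeierstrassCurve
open Literature.NumberTheory.EllipticCurves
open Literature.NumberTheory.GaloisRepresentations
open Literature.NumberTheory.GaloisRepresentations.DiscreteGaloisModule (SelmerStructure localTatePairingZMod tateDual)
open Literature.NumberTheory.GaloisCohomology
open Literature.NumberTheory.GaloisCohomology.LocalInvariants
open Summit.BirchSwinnertonDyer.Rank1Residual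
open Summit.BirchSwinnertonDyer.Rank1Residual.X11b.LocBridge
open Summit.BirchSwinnertonDyer.Rank1Residual.X11b.Levels
open Summit.BirchSwinnertonDyer.Rank1Residual.X5.SelfDualCount
open Summit.BirchSwinnertonDyer.Rank1Residual.X11b.KummerPT (kummerRelaxed kummerStrict kummerRelaxed_of_mem kummerRelaxed_of_not_mem
  kummerStrict_of_mem kummerStrict_of_not_mem)
open Summit.BirchSwinnertonDyer.Rank1Residual.X11b.CongruentTransfer
open Summit.BirchSwinnertonDyer.Rank1Residual.GaloisImage.CoreRankZero (selmerGroup_mono)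
open Summit.BirchSwinnertonDyer.Rank1Residual.X11b.SelmerCount (card_mul_relIndex_of_le)
open Summit.BirchSwinnertonDyer.BirchSwinnertonDyer.Theorems.GenusKolyArch

namespace Summit.BirchSwinnertonDyer.BirchSwinnertonDyer.Theorems.GenusExact.TwinSwap.IdentityDoor

-- Cup products need `LocallyCompactSpace Γ`; local instances as in X5 `SelfDualCount` / gk2-p5's archimedean files.
attribute [local instance] absoluteGaloisGroup_compactSpace
attribute [local instance] finite_geomTorsion_of_neZero Literature.NumberTheory.EllipticCurves.finite_muCarrier

/-! ## §1 The mixed two-place Kummer count: one real and one finite place -/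

section MixedCount

variable {K : Type} [Field K] [NumberField K] (W : WeierstrassCurve K) (n : ℕ) [NeZero n] [W.IsElliptic]

/-- **THE MIXED TWO-PLACE KUMMER COUNT** (Mazur–Rubin Lemma 3.2 with `T = {w, v₀}`, `w` REAL, `v₀` finite): for `n` a prime power, a Poitou–Tate
family `inv` (perfect at finite places, reciprocity, Howard's complement, injective at the real places) and Tate's local Euler characteristic at the
finite places: `[H¹(𝓚 relaxed at w and v₀) : H¹(𝓚 strict at w and v₀)] = #𝓛_w · (#E(K_{v₀})[n] · #(𝓞_{v₀}/n))`, `𝓛_w = im κ_w` the archimedean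
Kummer condition.  Proof: the chain `𝓚_{w,v₀} ≤ 𝓚_{v₀} ≤ 𝓚^{v₀} ≤ 𝓚^{w,v₀}`; the middle index is X5's finite Kummer count; Howard's count at the
real place `w` for the pair `𝓚^{v₀} ≤ 𝓚^{w,v₀}` — whose transported duals are `𝓚_{v₀}` and `𝓚_{w,v₀}` — gives (outer index) · (inner index)
`= [H¹(K_w, E[n]) : 𝓛_w] = #𝓛_w`.  [cite: MazurRubin2010, Lemma 3.2] [cite: Howard2004HeegnerKolyvagin, Thm. 2.1.11 (arXiv:1202.6340 p. 6)]
[cite: MilneADT2006, Ch. I, Thm. 2.13, Thm. 4.10 and Lemma 6.15] -/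
theorem relIndex_kummer_update₂_inl_inr_eq (hn : IsPrimePow n) (inv : LocalInvariants K n)
    (hperf : inv.IsPerfect) (hvan : inv.SumLocalTermEqZero) (hcomp : inv.SelmerComplement)
    (hEP : ∀ v : HeightOneSpectrum (𝓞 K), localEulerPoincareCharacteristic (v.adicCompletion K))
    (hreal : ∀ w : InfinitePlace K, w.IsReal → Injective (inv (Sum.inl w)))
    {w : InfinitePlace K} (hw : w.IsReal) (v₀ : HeightOneSpectrum (𝓞 K)) :
    (SelmerStructure.selmerGroup (Function.update (Function.update (W.kummerSelmerStructure (n : ℤ)) (Sum.inl w) ⊥)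
          (Sum.inr v₀) ⊥ : SelmerStructure (W.torsionGaloisModule (n : ℤ)))).relIndex
        (SelmerStructure.selmerGroup (Function.update (Function.update (W.kummerSelmerStructure (n : ℤ)) (Sum.inl w) ⊤)
          (Sum.inr v₀) ⊤ : SelmerStructure (W.torsionGaloisModule (n : ℤ)))) =
      Nat.card (W.kummerSelmerStructure (n : ℤ) (Sum.inl w)) *
        (Nat.card (nsmulAddMonoidHom n : (W.baseChange (v₀.adicCompletion K)).toAffine.Point →+ _).ker *
          Nat.card (v₀.adicCompletionIntegers K ⧸ Ideal.span {(n : v₀.adicCompletionIntegers K)})) := by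
  have h12 : (Sum.inl w : Place K) ≠ Sum.inr v₀ := Sum.inl_ne_inr
  -- the four structures of the chain `A ≤ P ≤ Q ≤ D`
  set 𝓚 : SelmerStructure (W.torsionGaloisModule (n : ℤ)) := W.kummerSelmerStructure (n : ℤ) with h𝓚def
  set P : SelmerStructure (W.torsionGaloisModule (n : ℤ)) := Function.update 𝓚 (Sum.inr v₀) ⊥ with hP
  set Q : SelmerStructure (W.torsionGaloisModule (n : ℤ)) := Function.update 𝓚 (Sum.inr v₀) ⊤ with hQ
  set A : SelmerStructure (W.torsionGaloisModule (n : ℤ)) := Function.update P (Sum.inl w) ⊥ with hA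
  set D : SelmerStructure (W.torsionGaloisModule (n : ℤ)) := Function.update Q (Sum.inl w) ⊤ with hD
  have hAeq : (Function.update (Function.update 𝓚 (Sum.inl w) ⊥) (Sum.inr v₀) ⊥ :
      SelmerStructure (W.torsionGaloisModule (n : ℤ))) = A := by
    rw [hA, hP, Function.update_comm h12]
  have hDeq : (Function.update (Function.update 𝓚 (Sum.inl w) ⊤) (Sum.inr v₀) ⊤ :
      SelmerStructure (W.torsionGaloisModule (n : ℤ))) = D := by
    rw [hD, hQ, Function.update_comm h12]
  rw [hAeq, hDeq]
  -- pointwise orders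
  have hAP : A ≤ P := fun v ↦ by
    by_cases hv : v = Sum.inl w
    · subst hv; rw [hA, Function.update_self]; exact bot_le
    · rw [hA, Function.update_of_ne hv]
  have hPQ : P ≤ Q := update_bot_le_update_top W n 𝓚 (Sum.inr v₀)
  have hQD : Q ≤ D := fun v ↦ by
    by_cases hv : v = Sum.inl w
    · subst hv; rw [hD, Function.update_self]; exact le_top
    · rw [hD, Function.update_of_ne hv]
  -- the middle index: X5's finite Kummer count
  have hmid : P.selmerGroup.relIndex Q.selmerGroup =
      Nat.card (nsmulAddMonoidHom n : (W.baseChange (v₀.adicCompletion K)).toAffine.Point →+ _).ker *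
        Nat.card (v₀.adicCompletionIntegers K ⧸ Ideal.span {(n : v₀.adicCompletionIntegers K)}) :=
    relIndex_kummer_update_bot_update_top_eq W n hn inv hperf hvan hcomp hEP hreal v₀
  -- `n = p^k`
  obtain ⟨p, k, hp, hk, rfl⟩ := (isPrimePow_nat_iff n).mp hn
  haveI : Fact p.Prime := ⟨hp⟩
  -- a Weil pairing on `E[p^k]`
  obtain ⟨e, hμ, hadd₁, hadd₂, halt, hnondeg, hgal⟩ := exists_weilPairing_holds W (p ^ k)
    (hp.two_le.trans (Nat.le_self_pow hk.ne' p)) (Nat.cast_ne_zero.mpr (NeZero.ne (p ^ k)))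
  set θ := weilDualIntertwining W (p ^ k) e hμ hadd₁ hadd₂ hgal with hθ
  -- a finite exceptional set `S ⊇ {w, v₀} ∪ ∞ ∪ {v ∣ p} ∪ {bad}`
  obtain ⟨S, hsub, hinf, hpS, hbad⟩ :=
    X11b.KummerPT.exists_exceptional_finset W p {(Sum.inl w : Place K), Sum.inr v₀}
  have hwS : (Sum.inl w : Place K) ∈ S := hinf w
  have hv₀S : (Sum.inr v₀ : Place K) ∈ S := hsub (by simp)
  have hS : ∀ v : HeightOneSpectrum (𝓞 K), (Sum.inr v : Place K) ∉ S →
      (((p ^ k : ℕ) : ℕ) : 𝓞 K) ∉ v.asIdeal ∧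
        GaloisRep.IsUnramifiedAt v (W.torsionGaloisModule ((p ^ k : ℕ) : ℤ)) := fun v hv => by
    have hpv : ((p : ℕ) : 𝓞 K) ∉ v.asIdeal := fun h => hv (hpS v h)
    have hgood : W.HasGoodReductionAt v := by_contra fun h => hv (hbad v h)
    have hpkv : ((p ^ k : ℕ) : 𝓞 K) ∉ v.asIdeal := by
      rw [Nat.cast_pow]
      exact fun h => hpv (v.isPrime.mem_of_pow_mem k h)
    exact ⟨hpkv, X11b.AcSelmer.isUnramifiedAt_torsionGaloisModule W hgood
      (by rw [Int.cast_natCast]; exact hpkv)⟩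
  have h𝓚S : SelmerStructure.IsUnramifiedOutside 𝓚 S :=
    X11b.KummerDuality.kummerSelmerStructure_isUnramifiedOutside W p k S hinf hpS hbad
  have hQS : Q.IsUnramifiedOutside S := isUnramifiedOutside_update W (p ^ k) h𝓚S hv₀S ⊤
  have hDS : D.IsUnramifiedOutside S := isUnramifiedOutside_update_inl W (p ^ k) hQS w ⊤
  have hM : ∀ T : geomTorsion W (p ^ k), (p ^ k) • T = 0 := fun T => AddSubgroup.torsionBy.nsmul T
  have hι : Injective (inv (Sum.inl w)) := hreal w hw
  haveI := finite_galoisCohomology_one_torsion_inl W (p ^ k) w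
  haveI := finite_galoisCohomology_one_tateDual_torsion_inl W (p ^ k) w
  have hbij := bijective_localTatePairingZMod_inl W (p ^ k) e hμ hadd₁ hadd₂ hgal halt hnondeg inv w hι
  -- the Kummer structure is residually self-dual everywhere
  have hsd : ∀ v, inv.dualTransported 𝓚 θ v = 𝓚 v := fun v =>
    dualTransported_kummerSelmerStructure_eq W (p ^ k) e hμ hadd₁ hadd₂ hgal halt hnondeg inv hn hperf hEP hreal v
  -- the transported duals: `w⁻¹Q^* = P`, `w⁻¹D^* = A`
  have hTQ : inv.dualTransported Q θ = P := by
    rw [hQ, dualTransported_update_top W (p ^ k) e hμ hadd₁ hadd₂ hgal hnondeg inv hperf 𝓚 v₀, funext hsd]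
  have hTD : inv.dualTransported D θ = A := by
    rw [hD, dualTransported_update_top_inl W (p ^ k) e hμ hadd₁ hadd₂ hgal halt hnondeg inv w hι Q, hTQ]
  have hdQ : (inv.dualSelmerStructure (W.torsionGaloisModule ((p ^ k : ℕ) : ℤ)) Q).selmerGroup =
      P.selmerGroup.map (galoisCohomology.map θ 1) := by
    rw [dualSelmerGroup_eq_map_selmerGroup_dualTransported W (p ^ k) e hμ hadd₁ hadd₂ hgal hnondeg inv Q, hTQ]
  have hdD : (inv.dualSelmerStructure (W.torsionGaloisModule ((p ^ k : ℕ) : ℤ)) D).selmerGroup =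
      A.selmerGroup.map (galoisCohomology.map θ 1) := by
    rw [dualSelmerGroup_eq_map_selmerGroup_dualTransported W (p ^ k) e hμ hadd₁ hadd₂ hgal hnondeg inv D, hTD]
  -- Howard's count at the real place `w` for `Q ≤ D`
  have hcount := relIndex_selmerGroup_mul_relIndex_dual_eq_of_bijective
    (ρ := W.torsionGaloisModule ((p ^ k : ℕ) : ℤ)) (𝓕 := Q) (𝓖 := D) (v₀ := (Sum.inl w : Place K)) hbij hvan hcomp hM hS
    hQD hQS hDS hwS (fun v hv => by rw [hD, Function.update_of_ne hv])
  rw [hdQ, hdD, AddSubgroup.relIndex_map_map_of_injective _ _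
    (map_weilDual_injective W (p ^ k) e hμ hadd₁ hadd₂ hgal hnondeg)] at hcount
  -- `[H¹(K_w, E[n]) : 𝓛_w] = #𝓛_w`
  have hloc : (Q (Sum.inl w)).relIndex (D (Sum.inl w)) = Nat.card (𝓚 (Sum.inl w)) := by
    have hQw : Q (Sum.inl w) = 𝓚 (Sum.inl w) := by rw [hQ, Function.update_of_ne h12]
    have hDw : D (Sum.inl w) = ⊤ := by rw [hD, Function.update_self]
    rw [hQw, hDw, AddSubgroup.relIndex_top_right]
    have hsq := natCard_galoisCohomology_one_torsion_inl_eq_sq W (p ^ k) e hμ hadd₁ hadd₂ hgal halt hnondeg inv w hι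
    have hci := (𝓚 (Sum.inl w)).card_mul_index
    rw [hsq] at hci
    have hpos : 0 < Nat.card (𝓚 (Sum.inl w)) := Nat.card_pos
    exact Nat.eq_of_mul_eq_mul_left hpos hci
  rw [hloc] at hcount
  -- multiply along the chain
  have hchain : A.selmerGroup.relIndex D.selmerGroup =
      A.selmerGroup.relIndex P.selmerGroup * P.selmerGroup.relIndex Q.selmerGroup * Q.selmerGroup.relIndex D.selmerGroup := by
    rw [AddSubgroup.relIndex_mul_relIndex _ _ _ (selmerGroup_mono hAP) (selmerGroup_mono hPQ),
      AddSubgroup.relIndex_mul_relIndex _ _ _ (selmerGroup_mono (hAP.trans hPQ)) (selmerGroup_mono hQD)]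
  rw [hchain, hmid, ← hcount]
  ring

/-- **The mixed two-place Kummer count in X11b's `kummerStrict` / `kummerRelaxed` spelling, CONDITIONAL on the two named facts**
`poitouTate_selmerStructure_duality_real K` and `localEulerPoincareCharacteristic` (both tree theorems over every number field): for a prime `p`, a REAL place
`w` and a finite place `v₀`, `[H¹_{𝓚^{w,v₀}} : H¹_{𝓚_{w,v₀}}] = #𝓛_w · (#E(K_{v₀})[p] · #(𝓞_{v₀}/p))`.  The `{∞, v₀}`-companion of X11b's
`relIndex_kummerStrict_kummerRelaxed_singleton_eq_of_facts` / `…_pair_eq_of_facts`.  [cite: MazurRubin2010, Lemma 3.2] [cite: MilneADT2006, Ch. I, Thm. 4.10] -/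
theorem relIndex_kummerStrict_kummerRelaxed_inl_inr_eq_of_facts (p : ℕ) [hp : Fact p.Prime]
    (hPT : poitouTate_selmerStructure_duality_real K)
    (hEP : ∀ v : HeightOneSpectrum (𝓞 K), localEulerPoincareCharacteristic (v.adicCompletion K))
    {w : InfinitePlace K} (hw : w.IsReal) (v₀ : HeightOneSpectrum (𝓞 K)) :
    (kummerStrict W p {(Sum.inl w : Place K), Sum.inr v₀}).selmerGroup.relIndex
        (kummerRelaxed W p {(Sum.inl w : Place K), Sum.inr v₀}).selmerGroup =
      Nat.card (W.kummerSelmerStructure (p : ℤ) (Sum.inl w)) *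
        (Nat.card (nsmulAddMonoidHom p : (W.baseChange (v₀.adicCompletion K)).toAffine.Point →+ _).ker *
          Nat.card (v₀.adicCompletionIntegers K ⧸ Ideal.span {(p : v₀.adicCompletionIntegers K)})) := by
  haveI : NeZero p := ⟨hp.out.ne_zero⟩
  have h12 : (Sum.inl w : Place K) ≠ Sum.inr v₀ := Sum.inl_ne_inr
  rw [kummerStrict_pair_eq_update₂ W p h12, kummerRelaxed_pair_eq_update₂ W p h12]
  obtain ⟨inv, hperf, hvan, -, hcomp, hreal⟩ := hPT p
  exact relIndex_kummer_update₂_inl_inr_eq W p hp.out.isPrimePow inv hperf hvan hcomp hEP hreal hw v₀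

end MixedCount

/-! ## §2 The abstract identity-door law: `#Sel^{(p)}(Y) · #H¹_{𝓚_{w}}(E) ∣ t_{v₀}(E, p)` -/

section IdentityDoorLaw

variable {K : Type} [Field K] [NumberField K] (W Y : WeierstrassCurve K) [W.IsElliptic] (p : ℕ) [hp : Fact p.Prime]

omit [W.IsElliptic] hp in
/-- `𝓚_{S} ≤ 𝓚^{{w}}` for `w ∈ S` (pointwise: `⊥` on `S`, `𝓚_v ≤ 𝓚_v` or `≤ ⊤` off `S`). [folklore] -/
theorem kummerStrict_le_kummerRelaxed_singleton_of_mem (S : Finset (Place K)) {v₁ : Place K} (hv₁ : v₁ ∈ S) :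
    kummerStrict W p S ≤ kummerRelaxed W p {v₁} := by
  intro v
  by_cases hv : v ∈ S
  · rw [kummerStrict_of_mem W p S hv]; exact bot_le
  · have hne : v ∉ ({v₁} : Finset (Place K)) := fun h ↦ hv (by rw [Finset.mem_singleton.mp h]; exact hv₁)
    rw [kummerStrict_of_not_mem W p S hv, kummerRelaxed_of_not_mem W p _ hne]

omit [W.IsElliptic] hp in
/-- `𝓚^{{w}} ≤ 𝓚^{S}` for `w ∈ S` (relaxing more places only enlarges the conditions). [folklore] -/
theorem kummerRelaxed_singleton_le_kummerRelaxed_of_mem (S : Finset (Place K)) {v₁ : Place K} (hv₁ : v₁ ∈ S) :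
    kummerRelaxed W p {v₁} ≤ kummerRelaxed W p S := by
  intro v
  by_cases hv : v ∈ S
  · rw [kummerRelaxed_of_mem W p S hv]; exact le_top
  · have hne : v ∉ ({v₁} : Finset (Place K)) := fun h ↦ hv (by rw [Finset.mem_singleton.mp h]; exact hv₁)
    rw [kummerRelaxed_of_not_mem W p S hv, kummerRelaxed_of_not_mem W p _ hne]

/-- **THE ABSTRACT IDENTITY-DOOR LAW** (Mazur–Rubin's method at `T = {w, v₀}`, `w` REAL, with the `∞`-RELAXED Selmer group as pivot).
For a congruent pair `φ : Y[p] ⥲ E[p]` (inverse `ψ`) over a number field `K`, the transported Kummer structure `𝓐 = φ_* 𝓚_Y`, a real place `w`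
and a finite place `v₀` such that: `𝓐` AGREES with `𝓚_E` at every place other than `w, v₀`; `𝓐` is TRANSVERSE to `𝓚_E` at `v₀`
(`𝓐_{v₀} ⊓ 𝓚_{E,v₀} = ⊥`, Lemma 2.11 for twists); and the localisation at `v₀` is INJECTIVE on the `w`-relaxed Selmer group `H¹_{𝓚^{w}}(E)`
(for `K = ℚ`, `p = 2`: on `Sel₂^{rel ∞}(E)`).  THEN **`#Sel^{(p)}(Y) · #H¹_{𝓚_{w}}(E) ∣ #E(K_{v₀})[p] · #(𝓞_{v₀}/p)`** — NO hypothesis on `𝓐_w`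
(the disagreement at the real place is absorbed by the relaxation).  Proof: `H¹_{𝓚_{w,v₀}} ≤ H¹_{𝓚^{w}} ∩ ker loc_{v₀} = 0`, so §1 reads
`#H¹_{𝓚^{w,v₀}} = #𝓛_w · t_{v₀}`, and `#H¹_{𝓚^{w}} = #𝓛_w · #H¹_{𝓚_{w}}` (gk2-p5's archimedean count); `H¹_𝓐, H¹_{𝓚^{w}} ≤ H¹_{𝓚^{w,v₀}}` meet
trivially (a common class localises into `𝓐_{v₀} ⊓ 𝓚_{v₀} = 0`, then injectivity), so `#H¹_𝓐 · #H¹_{𝓚^{w}} ∣ #H¹_{𝓚^{w,v₀}}`; cancel `#𝓛_w` and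
transport `#H¹_𝓐 = #Sel(Y)`.  CONDITIONAL only on the displayed print facts `hPT`, `hEP` (tree theorems over every `K`).
[cite: MazurRubin2010, Def. 3.1, Lemma 3.2, Prop. 3.3 (method)] [cite: Howard2004HeegnerKolyvagin, Thm. 2.1.11 (arXiv:1202.6340 p. 6)]
[cite: MilneADT2006, Ch. I, Thm. 2.13 and Thm. 4.10] -/
theorem natCard_selmerGroup_mul_natCard_dvd_of_transverse_of_injective_relaxed
    (hPT : poitouTate_selmerStructure_duality_real K)
    (hEP : ∀ v : HeightOneSpectrum (𝓞 K), localEulerPoincareCharacteristic (v.adicCompletion K))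
    (φ : (Y.torsionGaloisModule (p : ℤ)).toContRepresentation →ⁱL
      (W.torsionGaloisModule (p : ℤ)).toContRepresentation)
    (ψ : (W.torsionGaloisModule (p : ℤ)).toContRepresentation →ⁱL
      (Y.torsionGaloisModule (p : ℤ)).toContRepresentation)
    (hψφ : ∀ a, ψ (φ a) = a) (hφψ : ∀ b, φ (ψ b) = b)
    (𝓐 : SelmerStructure (W.torsionGaloisModule (p : ℤ)))
    (h𝓐 : ∀ v, 𝓐 v = (Y.kummerSelmerStructure (p : ℤ) v).map
      (galoisCohomology.map (φ.restrictField (Place.Completion v)) 1))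
    {w : InfinitePlace K} (hw : w.IsReal) (v₀ : HeightOneSpectrum (𝓞 K))
    (hagree : ∀ v : Place K, v ≠ Sum.inl w → v ≠ Sum.inr v₀ → 𝓐 v = W.kummerSelmerStructure (p : ℤ) v)
    (htr : 𝓐 (Sum.inr v₀) ⊓ W.kummerSelmerStructure (p : ℤ) (Sum.inr v₀) = ⊥)
    (hinj : ∀ c ∈ (kummerRelaxed W p {(Sum.inl w : Place K)}).selmerGroup,
      galoisCohomology.localization (W.torsionGaloisModule (p : ℤ)) (Sum.inr v₀) 1 c = 0 → c = 0) :
    Nat.card (Y.selmerGroup (p : ℤ)) * Nat.card (kummerStrict W p {(Sum.inl w : Place K)}).selmerGroup ∣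
      Nat.card (nsmulAddMonoidHom p : (W.baseChange (v₀.adicCompletion K)).toAffine.Point →+ _).ker *
        Nat.card (v₀.adicCompletionIntegers K ⧸ Ideal.span {(p : v₀.adicCompletionIntegers K)}) := by
  haveI : NeZero p := ⟨hp.out.ne_zero⟩
  have h12 : (Sum.inl w : Place K) ≠ Sum.inr v₀ := Sum.inl_ne_inr
  set S : Finset (Place K) := {(Sum.inl w : Place K), Sum.inr v₀} with hSdef
  have hwS : (Sum.inl w : Place K) ∈ S := by simp [hSdef]
  have hv₀S : (Sum.inr v₀ : Place K) ∈ S := by simp [hSdef]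
  set R := (kummerRelaxed W p {(Sum.inl w : Place K)}).selmerGroup with hRdef
  set Str := (kummerStrict W p {(Sum.inl w : Place K)}).selmerGroup with hStrdef
  set D := (kummerRelaxed W p S).selmerGroup with hDdef
  set A := (kummerStrict W p S).selmerGroup with hAdef
  set B := 𝓐.selmerGroup with hBdef
  set t := Nat.card (nsmulAddMonoidHom p : (W.baseChange (v₀.adicCompletion K)).toAffine.Point →+ _).ker *
    Nat.card (v₀.adicCompletionIntegers K ⧸ Ideal.span {(p : v₀.adicCompletionIntegers K)}) with htdef
  set ℓw := Nat.card (W.kummerSelmerStructure (p : ℤ) (Sum.inl w)) with hℓwdef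
  -- orders: `A ≤ R ≤ D`, `Str ≤ R`, `B ≤ D`
  have hAR : A ≤ R := selmerGroup_mono (kummerStrict_le_kummerRelaxed_singleton_of_mem W p S hwS)
  have hRD : R ≤ D := selmerGroup_mono (kummerRelaxed_singleton_le_kummerRelaxed_of_mem W p S hwS)
  have hStrR : Str ≤ R := selmerGroup_mono (X11b.KummerPT.kummerStrict_le_kummerRelaxed W p _)
  have hagreeS : ∀ v ∉ S, 𝓐 v = W.kummerSelmerStructure (p : ℤ) v := fun v hv ↦
    hagree v (fun h ↦ hv (h ▸ hwS)) (fun h ↦ hv (h ▸ hv₀S))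
  have hBD : B ≤ D := (selmerGroup_sandwich_of_agree W p S hagreeS).2
  -- (b) `A = ⊥`
  have hA : A = ⊥ := by
    rw [eq_bot_iff]
    intro c hc
    rw [AddSubgroup.mem_bot]
    refine hinj c (hAR hc) ?_
    have h := (SelmerStructure.mem_selmerGroup_iff _ _).mp hc (Sum.inr v₀)
    rwa [kummerStrict_of_mem W p S hv₀S, AddSubgroup.mem_bot] at h
  -- (a) `#D = #𝓛_w · t`
  have hcardD : Nat.card D = ℓw * t := by
    have h := relIndex_kummerStrict_kummerRelaxed_inl_inr_eq_of_facts W p hPT hEP hw v₀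
    rw [← hAdef, ← hDdef, hA, AddSubgroup.relIndex_bot_left] at h
    exact h
  -- (d) `#R = #Str · #𝓛_w`
  have hcardR : Nat.card Str * ℓw = Nat.card R := by
    have h := relIndex_kummerStrict_kummerRelaxed_singleton_inl_eq_of_facts W p hp.out.isPrimePow hPT hEP w
    rw [← hStrdef, ← hRdef] at h
    have h' := card_mul_relIndex_of_le hStrR
    rw [h] at h'
    exact h'
  -- (e) `B ⊓ R = ⊥`
  have hBR : R ⊓ B = ⊥ := by
    rw [eq_bot_iff]
    intro c hc
    rw [AddSubgroup.mem_bot]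
    obtain ⟨hcR, hcB⟩ := AddSubgroup.mem_inf.mp hc
    refine hinj c hcR ?_
    have h1 := (SelmerStructure.mem_selmerGroup_iff _ _).mp hcB (Sum.inr v₀)
    have h2 := (SelmerStructure.mem_selmerGroup_iff _ _).mp hcR (Sum.inr v₀)
    have hne : (Sum.inr v₀ : Place K) ∉ ({(Sum.inl w : Place K)} : Finset (Place K)) := by simp
    rw [kummerRelaxed_of_not_mem W p _ hne] at h2
    have h3 : galoisCohomology.localization (W.torsionGaloisModule (p : ℤ)) (Sum.inr v₀) 1 c ∈
        𝓐 (Sum.inr v₀) ⊓ W.kummerSelmerStructure (p : ℤ) (Sum.inr v₀) := AddSubgroup.mem_inf.mpr ⟨h1, h2⟩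
    rwa [htr, AddSubgroup.mem_bot] at h3
  -- (f) counting: `#B ∣ [D : R]`, `[D : R] · #R = #D`
  have hBdvd : Nat.card B ∣ R.relIndex D := by
    have hchain := AddSubgroup.relIndex_mul_relIndex R (R ⊔ B) D le_sup_left (sup_le hRD hBD)
    have hRB : R.relIndex (R ⊔ B) = Nat.card B := by
      rw [AddSubgroup.relIndex_sup_left, ← AddSubgroup.inf_relIndex_right, hBR, AddSubgroup.relIndex_bot_left]
    rw [hRB] at hchain
    exact Dvd.intro _ hchain
  have hRDcard : Nat.card R * R.relIndex D = Nat.card D := card_mul_relIndex_of_le hRD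
  have hdvd : Nat.card B * Nat.card R ∣ Nat.card D := by
    rw [← hRDcard, mul_comm (Nat.card R)]
    exact Nat.mul_dvd_mul_right hBdvd _
  rw [hcardD, mul_comm ℓw t, ← hcardR, ← mul_assoc] at hdvd
  -- cancel `#𝓛_w ≠ 0`
  haveI := finite_galoisCohomology_one_torsion_inl W p w
  have hpos : 0 < ℓw := Nat.card_pos
  have hres : Nat.card B * Nat.card Str ∣ t := Nat.dvd_of_mul_dvd_mul_right hpos hdvd
  -- transport `#B = #Sel(Y)`
  rw [hBdef, natCard_selmerGroup_transport_kummer W Y p φ ψ hψφ hφψ 𝓐 h𝓐] at hres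
  exact hres

end IdentityDoorLaw

end Summit.BirchSwinnertonDyer.BirchSwinnertonDyer.Theorems.GenusExact.TwinSwap.IdentityDoor

end
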